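import Literature.Probability.RandomPlanarGeometry.SAWLoopErasureKestenRenewalSharp
import Literature.Barriers.CriticalPhenomena.RigorousRGSmallParameterFiniteRange
import HarnessLib

/-!
# The renewal floor to third order: `μ(ℤ^d) ≥ 2d − 1 − 1/(2d) − 1/d² − 11/(4d³) − O(d⁻⁴)`, via the exact `p₆(0)`

Topic `Literature/Probability/RandomPlanarGeometry`; a leaf over `SAWLoopErasureKestenRenewalSharp.lean` (by
name: the exact values `srwLaw_two_zero`, `srwLaw_two_single_two`, `srwLaw_two_corner`, `srwLaw_three_single`,
`srwLaw_four_zero`, and the renewal form `two_mul_div_renewal_le_connectiveConstant_of_le : G_d ≤ B →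
2d/(2 − 1/B) ≤ μ(ℤ^d)` of its parent `SAWLoopErasureKestenRenewal.lean`) and the finite-range lemma
`srwLaw_eq_zero_of_lt : n < ‖x‖₁ → pₙ(x) = 0` of
`Literature.Barriers.CriticalPhenomena.RigorousRGSmallParameterFiniteRange`; the simple-random-walk law `srwLaw d n x = pₙ(x)` is the lace build's
(`Literature.Barriers.CriticalPhenomena.LongRangePhi4.srwLaw`, recursion `srwLaw_succ_apply`), its Green function
`srwI d 1 0 0 = G_d = C₀(0,0;1/(2d))` and Taylor enclosure `abs_srwI_sub_taylor_le_kernel` are Fitzner–van der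
Hofstad's (`Literature/Probability/FitznerVanDerHofstad2017`).

SOURCES AS PRINTED. Hara–Slade–Sokal, *New lower bounds on the self-avoiding-walk connective constant*, J. Stat.
Phys. 72 (1993) 479–517 = arXiv:hep-lat/9302003 (held text `paper:arxiv-hep-lat_9302003`; page numbers are the
arXiv pages). §6.3 (p. 27), with `s = 1/(2d)`: eq. (6.18) "The standard of comparison for all our bounds is the
series `μ = s⁻¹ − 1 − s − 3s² − 16s³ − 102s⁴ − …` which is provably correct through order `s³`"; eq. (6.20)
"The next simplest bound (2.32) is based on τ = 0, k = 1; using (A.17) and (2.33), we obtain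
`μ^{(0,1)} = 2d / C^{{e}}(0,0;1/(2d)) = s⁻¹ − 1 − s − 4s² − 22s³ − 143s⁴ + O(s⁵)`. This gets the first three
terms correct, and just barely misses the term of order `s²`." Appendix A (p. 33): "In particular for
`C₀(0,x;1/(2d)) = I₁,₀(x)` we have `I₁₀(0) = 1 + s + 3s² + 12s³ + 60s⁴ + 355s⁵ + O(s⁶)`".

WHAT IS HERE (all `d`; standard axioms).
* Exact small-time values of the step distribution beyond the parent's `p₄(0)`, from the recursion
  `p_{n+1}(x) = (2d)⁻¹Σ_j (pₙ(x+e_j) + pₙ(x−e_j))` split at the (at most three) axes carrying `x` and the finite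
  range `pₙ(x) = 0` for `‖x‖₁ > n`: `srwLaw_three_single_three : p₃(3e_k) = s³`,
  `srwLaw_three_two_one : p₃(2e_k ± e_j) = 3s³`, `srwLaw_three_corner₃ : p₃(e_k ± e_j ± e_i) = 6s³`,
  `srwLaw_four_single_two : p₄(2e_k) = (12d − 8)s⁴`, `srwLaw_four_corner : p₄(e_k ± e_j) = (24d − 24)s⁴`,
  `srwLaw_five_single : p₅(e_k) = 15s³ − 45s⁴ + 40s⁵`, and **`srwLaw_six_zero : p₆(0) = 15/(8d³) − 45/(16d⁴) +
  5/(4d⁵)`** (`= 15s³ − 45s⁴ + 40s⁵ = u₆/(2d)⁶`, `u₆ = 120d³ − 180d² + 80d` closed six-step walks; `d = 1`: `5/16`,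
  `d = 2`: `25/256`) — the `s³` term `12s³ = s + 3s²·… ` bookkeeping of the printed `I₁₀(0)` series is now exact
  through `p₆`. The tree previously used only the Gaussian bound `p₆(0) ≤ 15/(8d³)` (`srwLaw_two_mul_zero_le`).
* The eleven-term Green-function enclosure (`d ≥ 5`) `srwI_one_zero_zero_le_sharp₁₁ :
  G_d ≤ 1 + 1/(2d) + 3/(4d²) + 3/(2d³) + 15/(4d⁴) + 985/(32d⁵) + 1124696/d⁶`, i.e. `1 + s + 3s² + 12s³ + 60s⁴ +
  985s⁵ + 2⁷√(23‼)·s⁶`: the printed (A.17) through order `s⁴` (`p₈ ≤ 105s⁴`, `p₁₀ ≤ 945s⁵` Gaussian).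
* **HEADLINE** (`d ≥ 5`): `kesten_third_order_renewal_sharp₁₁ :
  2d − 1 − 1/(2d) − 1/d² − 11/(4d³) − 49/d⁴ − 2249392/d⁵ ≤ μ(ℤ^d)`, i.e. `μ ≥ s⁻¹ − 1 − s − 4s² − 22s³ − O(s⁴)`:
  the printed `s³` coefficient `−22` of (6.20) as a rigorous inequality at every `d ≥ 5` (the parent file reached
  `−4s²` with `−72s³`; the truth is `−16s³`, (6.18)); and the renewal form
  `two_mul_div_renewal_sharp₁₁_le_connectiveConstant : 2d/(2 − 1/B₁₁(d)) ≤ μ(ℤ^d)`.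

HONEST SCOPE (numbers, not adjectives). The closed form is negative for `d ≤ 10`; it exceeds the parent's `R = 9`
closed form `2d − 1 − 1/(2d) − 1/d² − 9/d³ − 204704/d⁴` exactly from `d = 11` on (`d = 11`: 6.974 vs 6.958;
`d = 12`: 13.908 vs 13.074; `d = 20`: 38.269 vs 37.692; `d = 50`: 98.98237 vs 98.95678; `d = 100`: 198.994672 vs
198.992844, against `μ(ℤ¹⁰⁰) = 198.99492…` from (6.18) — the gap to the truth shrinks from `2.1·10⁻³` to
`2.5·10⁻⁴`). The renewal form itself gives `5.03` at `d = 5`, `12.97` at `d = 10`, `18.49` at `d = 12`. The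
`d⁻⁴`, `d⁻⁵` constants are crude (`49·16 = 784` vs the series coefficient `773` of the `R = 11` floor, itself
far from the printed `−143s⁴` because `p₈, p₁₀` are only Gaussian-bounded; `2249392 = 2·1124696` is twice the
Taylor remainder constant). Printed status: (6.18)/(6.20)/(A.17) are PRINTED asymptotic series; the all-`d`
inequality with explicit constants and the kernel-exact `p₆(0)` on the lace build's `srwLaw` are this file's
(LANE: CONSOLIDATION of (6.20) at order `s³`; no new mathematics is claimed — the novelty is the formal, all-`d`,
explicit-constant form and the exact lattice-walk values as by-name lemmas reusable by the loop-erasure files).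

## References
- [HSS93] T. Hara, G. Slade, A. D. Sokal, New lower bounds on the self-avoiding-walk connective constant,
  J. Stat. Phys. 72 (1993) 479–517, arXiv:hep-lat/9302003 — §2.3 (2.32)–(2.33), §6.3 (6.18)–(6.20), Appendix A (A.17).
- [FvdH17] R. Fitzner, R. van der Hofstad, Mean-field behavior for nearest-neighbor percolation in d > 10 (the
  NoBLE Taylor remainder, (5.1)) — the `srwI` enclosure machinery used by name.
-/

noncomputable section

open Finset
open scoped BigOperators Nat

namespace Literature.Probability.RandomPlanarGeometry.SAW.Zd.LoopErasure

open Literature.Probability.LatticeModels Literature.Probability.LatticeModels.SRW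
open Literature.Barriers.CriticalPhenomena Literature.Barriers.CriticalPhenomena.LongRangePhi4
open Literature.Probability.FitznerVanDerHofstad2017

variable {d : ℕ}

/-! ### Third order: the exact `p₆(0)` and HSS93 (6.20) through `s³` -/

/-- One coordinate bounds the `ℓ¹`-norm from below. [folklore] -/
private theorem natAbs_le_sum_natAbs (v : Site d) (a : Fin d) : (v a).natAbs ≤ ∑ i, (v i).natAbs :=
  Finset.single_le_sum (f := fun i => (v i).natAbs) (fun _ _ => Nat.zero_le _) (Finset.mem_univ a)

/-- Two coordinates bound the `ℓ¹`-norm from below. [folklore] -/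
private theorem natAbs_add_le_sum_natAbs (v : Site d) {a b : Fin d} (hab : a ≠ b) :
    (v a).natAbs + (v b).natAbs ≤ ∑ i, (v i).natAbs := by
  have hsub : ∑ i ∈ ({a, b} : Finset (Fin d)), (v i).natAbs ≤ ∑ i, (v i).natAbs :=
    Finset.sum_le_sum_of_subset_of_nonneg (Finset.subset_univ _) (fun _ _ _ => Nat.zero_le _)
  rwa [Finset.sum_pair hab] at hsub

/-- Three coordinates bound the `ℓ¹`-norm from below. [folklore] -/
private theorem natAbs_add_add_le_sum_natAbs (v : Site d) {a b c : Fin d} (hab : a ≠ b) (hac : a ≠ c)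
    (hbc : b ≠ c) : (v a).natAbs + (v b).natAbs + (v c).natAbs ≤ ∑ i, (v i).natAbs := by
  have hsub : ∑ i ∈ ({a, b, c} : Finset (Fin d)), (v i).natAbs ≤ ∑ i, (v i).natAbs :=
    Finset.sum_le_sum_of_subset_of_nonneg (Finset.subset_univ _) (fun _ _ _ => Nat.zero_le _)
  have ha : a ∉ ({b, c} : Finset (Fin d)) := by simp [hab, hac]
  rw [Finset.sum_insert ha, Finset.sum_pair hbc] at hsub
  omega

/-- Finite range, one coordinate: `p_n(v) = 0` if `n < |v_a|`. [folklore] -/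
private theorem srwLaw_eq_zero_far₁ {n : ℕ} (v : Site d) (a : Fin d) (h : n < (v a).natAbs) :
    srwLaw d n v = 0 :=
  srwLaw_eq_zero_of_lt n v (lt_of_lt_of_le h (natAbs_le_sum_natAbs v a))

/-- Finite range, two coordinates: `p_n(v) = 0` if `n < |v_a| + |v_b|` (`a ≠ b`). [folklore] -/
private theorem srwLaw_eq_zero_far₂ {n : ℕ} (v : Site d) {a b : Fin d} (hab : a ≠ b)
    (h : n < (v a).natAbs + (v b).natAbs) : srwLaw d n v = 0 :=
  srwLaw_eq_zero_of_lt n v (lt_of_lt_of_le h (natAbs_add_le_sum_natAbs v hab))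

/-- Finite range, three coordinates. [folklore] -/
private theorem srwLaw_eq_zero_far₃ {n : ℕ} (v : Site d) {a b c : Fin d} (hab : a ≠ b) (hac : a ≠ c)
    (hbc : b ≠ c) (h : n < (v a).natAbs + (v b).natAbs + (v c).natAbs) : srwLaw d n v = 0 :=
  srwLaw_eq_zero_of_lt n v (lt_of_lt_of_le h (natAbs_add_add_le_sum_natAbs v hab hac hbc))

/-- **`p₂(σe_a + τe_b) = 2/(2d)²`** for `a ≠ b`, `σ, τ = ±1` (both signs free).
[cite: HaraSladeSokal1993, Appendix A, (A.17) (arXiv p. 33); lane plumbing] -/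
theorem srwLaw_two_corner_sign {a b : Fin d} (hab : a ≠ b) {σ τ : ℤ} (hσ : σ = 1 ∨ σ = -1)
    (hτ : τ = 1 ∨ τ = -1) : srwLaw d 2 ((Pi.single a σ : Site d) + Pi.single b τ) = 2 / (2 * (d : ℝ)) ^ 2 := by
  rcases hσ with rfl | rfl
  · exact srwLaw_two_corner hab hτ
  · have hτ' : -τ = 1 ∨ -τ = -1 := by rcases hτ with rfl | rfl <;> simp
    have e : ((Pi.single a (-1) : Site d) + Pi.single b τ) = -((Pi.single a 1 : Site d) + Pi.single b (-τ)) := by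
      rw [Pi.single_neg, Pi.single_neg, neg_add, neg_neg]
    rw [e, srwLaw_neg a.pos]
    exact srwLaw_two_corner hab hτ'

/-- **`p₂(ce_k) = 1/(2d)²`** for `c = ±2`. [cite: HaraSladeSokal1993, Appendix A, (A.17) (arXiv p. 33); lane plumbing] -/
theorem srwLaw_two_single_two_sign (k : Fin d) {c : ℤ} (hc : c = 2 ∨ c = -2) :
    srwLaw d 2 (Pi.single k c : Site d) = 1 / (2 * (d : ℝ)) ^ 2 := by
  rcases hc with rfl | rfl
  · exact srwLaw_two_single_two k
  · rw [Pi.single_neg, srwLaw_neg k.pos]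
    exact srwLaw_two_single_two k

/-- **`p₃(σe_k) = (6d − 3)/(2d)³`** for `σ = ±1`. [cite: HaraSladeSokal1993, Appendix A, (A.17) (arXiv p. 33); lane plumbing] -/
theorem srwLaw_three_single_sign (k : Fin d) {σ : ℤ} (hσ : σ = 1 ∨ σ = -1) :
    srwLaw d 3 (Pi.single k σ : Site d) = (6 * (d : ℝ) - 3) / (2 * (d : ℝ)) ^ 3 := by
  rcases hσ with rfl | rfl
  · exact srwLaw_three_single k
  · rw [Pi.single_neg, srwLaw_neg k.pos]
    exact srwLaw_three_single k

/-- **`p₃(3e_k) = 1/(2d)³`.** [cite: HaraSladeSokal1993, Appendix A, (A.17) (arXiv p. 33); lane plumbing] -/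
theorem srwLaw_three_single_three (k : Fin d) :
    srwLaw d 3 (Pi.single k 3 : Site d) = 1 / (2 * (d : ℝ)) ^ 3 := by
  rw [srwLaw_succ_apply]
  have hterm : ∀ j : Fin d, srwLaw d 2 ((Pi.single k 3 : Site d) + Pi.single j 1) +
      srwLaw d 2 ((Pi.single k 3 : Site d) - Pi.single j 1) = if j = k then 1 / (2 * (d : ℝ)) ^ 2 else 0 := by
    intro j
    by_cases hjk : j = k
    · subst hjk
      have hA : srwLaw d 2 ((Pi.single j 3 : Site d) + Pi.single j 1) = 0 := by
        refine srwLaw_eq_zero_far₁ _ j ?_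
        simp
      have hB : ((Pi.single j 3 : Site d) - Pi.single j 1) = Pi.single j 2 := by
        rw [← Pi.single_sub]; norm_num
      rw [hA, hB, srwLaw_two_single_two, if_pos rfl, zero_add]
    · have h0 : ∀ τ : ℤ, τ = 1 ∨ τ = -1 → srwLaw d 2 ((Pi.single k 3 : Site d) + Pi.single j τ) = 0 := by
        intro τ hτ
        refine srwLaw_eq_zero_far₂ _ (Ne.symm hjk) ?_
        rcases hτ with rfl | rfl <;> simp [hjk, Ne.symm hjk]
      rw [sub_eq_add_neg, ← Pi.single_neg, h0 1 (Or.inl rfl), h0 (-1) (Or.inr rfl), if_neg hjk, add_zero]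
  rw [Finset.sum_congr rfl (fun j _ => hterm j), Finset.sum_ite_eq' Finset.univ k, if_pos (Finset.mem_univ _)]
  ring

/-- **`p₃(2e_k + σe_j) = 3/(2d)³`** for `j ≠ k`, `σ = ±1`. [cite: HaraSladeSokal1993, Appendix A, (A.17) (arXiv p. 33); lane plumbing] -/
theorem srwLaw_three_two_one {j k : Fin d} (hjk : j ≠ k) {σ : ℤ} (hσ : σ = 1 ∨ σ = -1) :
    srwLaw d 3 ((Pi.single k 2 : Site d) + Pi.single j σ) = 3 / (2 * (d : ℝ)) ^ 3 := by
  rw [srwLaw_succ_apply]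
  set y : Site d := (Pi.single k 2 : Site d) + Pi.single j σ with hy
  have hyk : y k = 2 := by simp [hy, Ne.symm hjk]
  have hyj : y j = σ := by simp [hy, hjk]
  have hterm : ∀ i : Fin d, srwLaw d 2 (y + Pi.single i 1) + srwLaw d 2 (y - Pi.single i 1) =
      (if i = k then 2 / (2 * (d : ℝ)) ^ 2 else 0) + (if i = j then 1 / (2 * (d : ℝ)) ^ 2 else 0) := by
    intro i
    by_cases hik : i = k
    · subst hik
      rw [if_pos rfl, if_neg (Ne.symm hjk), add_zero]
      have hA : srwLaw d 2 (y + Pi.single i 1) = 0 := by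
        refine srwLaw_eq_zero_far₁ _ i ?_
        simp [hyk]
      have hB : y - Pi.single i 1 = (Pi.single i 1 : Site d) + Pi.single j σ := by
        rw [hy, add_sub_right_comm, ← Pi.single_sub]; norm_num
      rw [hA, hB, srwLaw_two_corner (Ne.symm hjk) hσ, zero_add]
    by_cases hij : i = j
    · subst hij
      rw [if_neg hik, if_pos rfl, zero_add]
      rcases hσ with rfl | rfl
      · have hA : srwLaw d 2 (y + Pi.single i 1) = 0 := by
          refine srwLaw_eq_zero_far₂ _ (Ne.symm hik) ?_
          simp [hyk, hyj, Ne.symm hik]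
        have hB : y - Pi.single i 1 = Pi.single k 2 := by rw [hy, add_sub_cancel_right]
        rw [hA, hB, srwLaw_two_single_two, zero_add]
      · have hA : y + Pi.single i 1 = Pi.single k 2 := by
          rw [hy, add_assoc, ← Pi.single_add]; simp
        have hB : srwLaw d 2 (y - Pi.single i 1) = 0 := by
          refine srwLaw_eq_zero_far₂ _ (Ne.symm hik) ?_
          simp [hyk, hyj, Ne.symm hik]
        rw [hA, hB, srwLaw_two_single_two, add_zero]
    · rw [if_neg hik, if_neg hij, add_zero]
      have hyi : y i = 0 := by simp [hy, hik, hij]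
      have h0 : ∀ τ : ℤ, τ = 1 ∨ τ = -1 → srwLaw d 2 (y + Pi.single i τ) = 0 := by
        intro τ hτ
        refine srwLaw_eq_zero_far₂ _ (Ne.symm hik) ?_
        rcases hτ with rfl | rfl <;> simp [hyk, hyi, Ne.symm hik]
      rw [sub_eq_add_neg, ← Pi.single_neg, h0 1 (Or.inl rfl), h0 (-1) (Or.inr rfl), add_zero]
  rw [Finset.sum_congr rfl (fun i _ => hterm i), Finset.sum_add_distrib, Finset.sum_ite_eq' Finset.univ k,
    Finset.sum_ite_eq' Finset.univ j, if_pos (Finset.mem_univ _), if_pos (Finset.mem_univ _)]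
  ring

/-- `p₃(ce_k + σe_j) = 3/(2d)³` for `j ≠ k`, `c = ±2`, `σ = ±1`. [cite: HaraSladeSokal1993, Appendix A, (A.17) (arXiv p. 33); lane plumbing] -/
theorem srwLaw_three_two_one_sign {j k : Fin d} (hjk : j ≠ k) {c : ℤ} (hc : c = 2 ∨ c = -2) {σ : ℤ}
    (hσ : σ = 1 ∨ σ = -1) : srwLaw d 3 ((Pi.single k c : Site d) + Pi.single j σ) = 3 / (2 * (d : ℝ)) ^ 3 := by
  rcases hc with rfl | rfl
  · exact srwLaw_three_two_one hjk hσ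
  · have hσ' : -σ = 1 ∨ -σ = -1 := by rcases hσ with rfl | rfl <;> simp
    have e : ((Pi.single k (-2) : Site d) + Pi.single j σ) = -((Pi.single k 2 : Site d) + Pi.single j (-σ)) := by
      rw [Pi.single_neg, Pi.single_neg, neg_add, neg_neg]
    rw [e, srwLaw_neg k.pos]
    exact srwLaw_three_two_one hjk hσ'

/-- **`p₃(e_k + σe_j + τe_i) = 6/(2d)³`** for distinct `i, j, k` and `σ, τ = ±1`.
[cite: HaraSladeSokal1993, Appendix A, (A.17) (arXiv p. 33); lane plumbing] -/
theorem srwLaw_three_corner₃ {i j k : Fin d} (hij : i ≠ j) (hik : i ≠ k) (hjk : j ≠ k) {σ τ : ℤ}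
    (hσ : σ = 1 ∨ σ = -1) (hτ : τ = 1 ∨ τ = -1) :
    srwLaw d 3 ((Pi.single k 1 : Site d) + Pi.single j σ + Pi.single i τ) = 6 / (2 * (d : ℝ)) ^ 3 := by
  rw [srwLaw_succ_apply]
  have hσ1 : σ.natAbs = 1 := by rcases hσ with rfl | rfl <;> rfl
  have hτ1 : τ.natAbs = 1 := by rcases hτ with rfl | rfl <;> rfl
  set y : Site d := (Pi.single k 1 : Site d) + Pi.single j σ + Pi.single i τ with hy
  have hyk : y k = 1 := by simp [hy, Ne.symm hjk, Ne.symm hik]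
  have hyj : y j = σ := by simp [hy, hjk, Ne.symm hij]
  have hyi : y i = τ := by simp [hy, hik, hij]
  have hterm : ∀ l : Fin d, srwLaw d 2 (y + Pi.single l 1) + srwLaw d 2 (y - Pi.single l 1) =
      (if l = k then 2 / (2 * (d : ℝ)) ^ 2 else 0) + (if l = j then 2 / (2 * (d : ℝ)) ^ 2 else 0) +
        (if l = i then 2 / (2 * (d : ℝ)) ^ 2 else 0) := by
    intro l
    by_cases hlk : l = k
    · subst hlk
      rw [if_pos rfl, if_neg (Ne.symm hjk), if_neg (Ne.symm hik), add_zero, add_zero]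
      have hA : srwLaw d 2 (y + Pi.single l 1) = 0 := by
        refine srwLaw_eq_zero_far₂ _ (Ne.symm hjk) ?_
        rcases hσ with rfl | rfl <;> simp [hyk, hyj, hjk]
      have hB : y - Pi.single l 1 = (Pi.single j σ : Site d) + Pi.single i τ := by rw [hy]; abel
      rw [hA, hB, srwLaw_two_corner_sign (Ne.symm hij) hσ hτ, zero_add]
    by_cases hlj : l = j
    · subst hlj
      rw [if_neg hlk, if_pos rfl, if_neg (Ne.symm hij), zero_add, add_zero]
      rcases hσ with rfl | rfl
      · have hA : srwLaw d 2 (y + Pi.single l 1) = 0 := by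
          refine srwLaw_eq_zero_far₂ _ hlk ?_
          simp [hyk, hyj, Ne.symm hlk]
        have hB : y - Pi.single l 1 = (Pi.single k 1 : Site d) + Pi.single i τ := by rw [hy]; abel
        rw [hA, hB, srwLaw_two_corner (Ne.symm hik) hτ, zero_add]
      · have hA : y + Pi.single l 1 = (Pi.single k 1 : Site d) + Pi.single i τ := by
          rw [hy, Pi.single_neg]; abel
        have hB : srwLaw d 2 (y - Pi.single l 1) = 0 := by
          refine srwLaw_eq_zero_far₂ _ hlk ?_
          simp [hyk, hyj, Ne.symm hlk]
        rw [hA, hB, srwLaw_two_corner (Ne.symm hik) hτ, add_zero]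
    by_cases hli : l = i
    · subst hli
      rw [if_neg hlk, if_neg hlj, if_pos rfl, zero_add, zero_add]
      rcases hτ with rfl | rfl
      · have hA : srwLaw d 2 (y + Pi.single l 1) = 0 := by
          refine srwLaw_eq_zero_far₂ _ hlk ?_
          simp [hyk, hyi, Ne.symm hlk]
        have hB : y - Pi.single l 1 = (Pi.single k 1 : Site d) + Pi.single j σ := by rw [hy]; abel
        rw [hA, hB, srwLaw_two_corner (Ne.symm hjk) hσ, zero_add]
      · have hA : y + Pi.single l 1 = (Pi.single k 1 : Site d) + Pi.single j σ := by
          rw [hy, Pi.single_neg]; abel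
        have hB : srwLaw d 2 (y - Pi.single l 1) = 0 := by
          refine srwLaw_eq_zero_far₂ _ hlk ?_
          simp [hyk, hyi, Ne.symm hlk]
        rw [hA, hB, srwLaw_two_corner (Ne.symm hjk) hσ, add_zero]
    · rw [if_neg hlk, if_neg hlj, if_neg hli, add_zero, add_zero]
      have h0 : ∀ ρ : ℤ, ρ = 1 ∨ ρ = -1 → srwLaw d 2 (y + Pi.single l ρ) = 0 := by
        intro ρ hρ
        refine srwLaw_eq_zero_far₃ _ (Ne.symm hjk) (Ne.symm hik) (Ne.symm hij) ?_
        rcases hρ with rfl | rfl <;> simp [hyk, hyj, hyi, hσ1, hτ1, Ne.symm hlk, Ne.symm hlj, Ne.symm hli]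
      rw [sub_eq_add_neg, ← Pi.single_neg, h0 1 (Or.inl rfl), h0 (-1) (Or.inr rfl), add_zero]
  rw [Finset.sum_congr rfl (fun l _ => hterm l), Finset.sum_add_distrib, Finset.sum_add_distrib,
    Finset.sum_ite_eq' Finset.univ k, Finset.sum_ite_eq' Finset.univ j, Finset.sum_ite_eq' Finset.univ i,
    if_pos (Finset.mem_univ _), if_pos (Finset.mem_univ _), if_pos (Finset.mem_univ _)]
  ring

/-- **`p₄(2e_k) = (12d − 8)/(2d)⁴`** (`= 12s³ − 16s⁴`). [cite: HaraSladeSokal1993, Appendix A, (A.17) (arXiv p. 33); lane plumbing] -/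
theorem srwLaw_four_single_two (k : Fin d) :
    srwLaw d 4 (Pi.single k 2 : Site d) = (12 * (d : ℝ) - 8) / (2 * (d : ℝ)) ^ 4 := by
  have hd : 1 ≤ d := k.pos
  have hd0 : (d : ℝ) ≠ 0 := by exact_mod_cast (show d ≠ 0 by omega)
  rw [srwLaw_succ_apply]
  have hterm : ∀ j : Fin d, srwLaw d 3 ((Pi.single k 2 : Site d) + Pi.single j 1) +
      srwLaw d 3 ((Pi.single k 2 : Site d) - Pi.single j 1) =
      6 / (2 * (d : ℝ)) ^ 3 + (if j = k then 1 / (2 * (d : ℝ)) ^ 3 + (6 * (d : ℝ) - 3) / (2 * (d : ℝ)) ^ 3 -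
        6 / (2 * (d : ℝ)) ^ 3 else 0) := by
    intro j
    by_cases hjk : j = k
    · subst hjk
      have hA : (Pi.single j 2 : Site d) + Pi.single j 1 = Pi.single j 3 := by rw [← Pi.single_add]; norm_num
      have hB : (Pi.single j 2 : Site d) - Pi.single j 1 = Pi.single j 1 := by rw [← Pi.single_sub]; norm_num
      rw [hA, hB, srwLaw_three_single_three, srwLaw_three_single, if_pos rfl]
      ring
    · rw [if_neg hjk, add_zero, sub_eq_add_neg, ← Pi.single_neg, srwLaw_three_two_one hjk (Or.inl rfl),
        srwLaw_three_two_one hjk (Or.inr rfl)]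
      ring
  rw [Finset.sum_congr rfl (fun j _ => hterm j), Finset.sum_add_distrib, Finset.sum_const, Finset.card_univ,
    Fintype.card_fin, Finset.sum_ite_eq' Finset.univ k, if_pos (Finset.mem_univ _), nsmul_eq_mul]
  field_simp
  ring

/-- **`p₄(e_k + σe_j) = (24d − 24)/(2d)⁴`** for `j ≠ k`, `σ = ±1` (`= 24s³ − 48s⁴`).
[cite: HaraSladeSokal1993, Appendix A, (A.17) (arXiv p. 33); lane plumbing] -/
theorem srwLaw_four_corner {j k : Fin d} (hjk : j ≠ k) {σ : ℤ} (hσ : σ = 1 ∨ σ = -1) :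
    srwLaw d 4 ((Pi.single k 1 : Site d) + Pi.single j σ) = (24 * (d : ℝ) - 24) / (2 * (d : ℝ)) ^ 4 := by
  have hd : 1 ≤ d := k.pos
  have hd0 : (d : ℝ) ≠ 0 := by exact_mod_cast (show d ≠ 0 by omega)
  rw [srwLaw_succ_apply]
  set y : Site d := (Pi.single k 1 : Site d) + Pi.single j σ with hy
  have hterm : ∀ i : Fin d, srwLaw d 3 (y + Pi.single i 1) + srwLaw d 3 (y - Pi.single i 1) =
      12 / (2 * (d : ℝ)) ^ 3 + (if i = k then (6 * (d : ℝ) - 3) / (2 * (d : ℝ)) ^ 3 - 9 / (2 * (d : ℝ)) ^ 3 else 0) +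
        (if i = j then (6 * (d : ℝ) - 3) / (2 * (d : ℝ)) ^ 3 - 9 / (2 * (d : ℝ)) ^ 3 else 0) := by
    intro i
    by_cases hik : i = k
    · subst hik
      rw [if_pos rfl, if_neg (Ne.symm hjk), add_zero]
      have hA : y + Pi.single i 1 = (Pi.single i 2 : Site d) + Pi.single j σ := by
        rw [hy, add_right_comm, ← Pi.single_add]; norm_num
      have hB : y - Pi.single i 1 = Pi.single j σ := by rw [hy]; abel
      rw [hA, hB, srwLaw_three_two_one hjk hσ, srwLaw_three_single_sign j hσ]
      ring
    by_cases hij : i = j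
    · subst hij
      rw [if_neg hik, if_pos rfl, add_zero]
      rcases hσ with rfl | rfl
      · have hA : y + Pi.single i 1 = (Pi.single i 2 : Site d) + Pi.single k 1 := by
          rw [hy, add_assoc, ← Pi.single_add, add_comm]; norm_num
        have hB : y - Pi.single i 1 = Pi.single k 1 := by rw [hy, add_sub_cancel_right]
        rw [hA, hB, srwLaw_three_two_one (Ne.symm hik) (Or.inl rfl), srwLaw_three_single]
        ring
      · have hA : y + Pi.single i 1 = Pi.single k 1 := by
          rw [hy, add_assoc, ← Pi.single_add]; simp
        have hB : y - Pi.single i 1 = (Pi.single i (-2) : Site d) + Pi.single k 1 := by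
          rw [hy, add_sub_assoc, ← Pi.single_sub, add_comm]; norm_num
        rw [hA, hB, srwLaw_three_single, srwLaw_three_two_one_sign (Ne.symm hik) (Or.inr rfl) (Or.inl rfl)]
        ring
    · rw [if_neg hik, if_neg hij, add_zero, add_zero]
      have hA : y + Pi.single i 1 = (Pi.single k 1 : Site d) + Pi.single j σ + Pi.single i 1 := by rw [hy]
      have hB : y - Pi.single i 1 = (Pi.single k 1 : Site d) + Pi.single j σ + Pi.single i (-1) := by
        rw [hy, sub_eq_add_neg, ← Pi.single_neg]
      rw [hA, hB, srwLaw_three_corner₃ hij hik hjk hσ (Or.inl rfl),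
        srwLaw_three_corner₃ hij hik hjk hσ (Or.inr rfl)]
      ring
  rw [Finset.sum_congr rfl (fun i _ => hterm i), Finset.sum_add_distrib, Finset.sum_add_distrib, Finset.sum_const,
    Finset.card_univ, Fintype.card_fin, Finset.sum_ite_eq' Finset.univ k, Finset.sum_ite_eq' Finset.univ j,
    if_pos (Finset.mem_univ _), if_pos (Finset.mem_univ _), nsmul_eq_mul]
  field_simp
  ring

/-- **`p₅(e_k) = 15/(8d³) − 45/(16d⁴) + 5/(4d⁵)`** (`= 15s³ − 45s⁴ + 40s⁵`, `s = 1/(2d)`).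
[cite: HaraSladeSokal1993, Appendix A, (A.17) (arXiv p. 33); lane plumbing] -/
theorem srwLaw_five_single (k : Fin d) :
    srwLaw d 5 (Pi.single k 1 : Site d) =
      15 / (8 * (d : ℝ) ^ 3) - 45 / (16 * (d : ℝ) ^ 4) + 5 / (4 * (d : ℝ) ^ 5) := by
  have hd : 1 ≤ d := k.pos
  have hd0 : (d : ℝ) ≠ 0 := by exact_mod_cast (show d ≠ 0 by omega)
  rw [srwLaw_succ_apply]
  have hterm : ∀ j : Fin d, srwLaw d 4 ((Pi.single k 1 : Site d) + Pi.single j 1) +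
      srwLaw d 4 ((Pi.single k 1 : Site d) - Pi.single j 1) =
      2 * ((24 * (d : ℝ) - 24) / (2 * (d : ℝ)) ^ 4) + (if j = k then (12 * (d : ℝ) - 8) / (2 * (d : ℝ)) ^ 4 +
        (3 / (4 * (d : ℝ) ^ 2) - 3 / (8 * (d : ℝ) ^ 3)) - 2 * ((24 * (d : ℝ) - 24) / (2 * (d : ℝ)) ^ 4) else 0) := by
    intro j
    by_cases hjk : j = k
    · subst hjk
      rw [← Pi.single_add, sub_self, one_add_one_eq_two, srwLaw_four_single_two, srwLaw_four_zero hd, if_pos rfl]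
      ring
    · rw [if_neg hjk, add_zero, sub_eq_add_neg, ← Pi.single_neg, srwLaw_four_corner hjk (Or.inl rfl),
        srwLaw_four_corner hjk (Or.inr rfl)]
      ring
  rw [Finset.sum_congr rfl (fun j _ => hterm j), Finset.sum_add_distrib, Finset.sum_const, Finset.card_univ,
    Fintype.card_fin, Finset.sum_ite_eq' Finset.univ k, if_pos (Finset.mem_univ _), nsmul_eq_mul]
  field_simp
  ring

/-- **`p₆(0) = 15/(8d³) − 45/(16d⁴) + 5/(4d⁵)`** (`d ≥ 1`): the exact six-step return probability of simple
random walk on `ℤ^d` (`= u₆/(2d)⁶` with `u₆ = 120d³ − 180d² + 80d` closed six-step walks; `15s³ − 45s⁴ + 40s⁵`,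
`s = 1/(2d)`; `d = 1`: `5/16 = 20/64`, `d = 2`: `25/256 = 400/4096`).
[cite: HaraSladeSokal1993, Appendix A, (A.17) (arXiv p. 33); lane plumbing] -/
theorem srwLaw_six_zero (hd : 1 ≤ d) :
    srwLaw d 6 (0 : Site d) = 15 / (8 * (d : ℝ) ^ 3) - 45 / (16 * (d : ℝ) ^ 4) + 5 / (4 * (d : ℝ) ^ 5) := by
  rw [srwLaw_succ_zero_eq_stepVec hd 5 (((⟨0, hd⟩ : Fin d), true) : Dir d),
    show stepVec (((⟨0, hd⟩ : Fin d), true) : Dir d) = (Pi.single (⟨0, hd⟩ : Fin d) 1 : Site d) by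
      simp [stepVec], srwLaw_five_single]

/-! ### The Green function at the origin with the exact `p₄(0)` and `p₆(0)` (`R = 11`) -/

/-- **`G_d ≤ 1 + 1/(2d) + 3/(4d²) + 3/(2d³) + 15/(4d⁴) + 985/(32d⁵) + 1124696/d⁶`** for `d ≥ 5`: the
eleven-term Taylor enclosure of `srwI d 1 0 0 = G_d` with `p₂, p₄, p₆` exact, `p₈ ≤ 105/(2d)⁴`,
`p₁₀ ≤ 945/(2d)⁵` (Gaussian domination) and the remainder `2⁷·√(23‼)/(2d)⁶ ≤ 1124696/d⁶`. In `s = 1/(2d)` the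
polynomial part reads `1 + s + 3s² + 12s³ + 60s⁴ + 985s⁵`, i.e. the printed series (A.17)
`1 + s + 3s² + 12s³ + 60s⁴ + 355s⁵ + …` through order `s⁴`.
[cite: HaraSladeSokal1993, Appendix A, eq. (A.17) (I₁,₀(0) = 1 + s + 3s² + 12s³ + 60s⁴ + 355s⁵ + …, s = 1/(2d))] -/
theorem srwI_one_zero_zero_le_sharp₁₁ (hd : 5 ≤ d) :
    srwI d 1 0 0 ≤ 1 + 1 / (2 * (d : ℝ)) + 3 / (4 * (d : ℝ) ^ 2) + 3 / (2 * (d : ℝ) ^ 3) + 15 / (4 * (d : ℝ) ^ 4) +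
      985 / (32 * (d : ℝ) ^ 5) + 1124696 / (d : ℝ) ^ 6 := by
  have hd1 : 1 ≤ d := by omega
  have hd0 : (0 : ℝ) < d := by exact_mod_cast (show 0 < d by omega)
  have h := abs_srwI_sub_taylor_le_kernel (d := d) (n := 0) (l := 0) (R := 11) (by omega)
    (by decide) (0 : Fin d → ℤ)
  have hp0 : srwLaw d 0 (0 : Fin d → ℤ) = 1 := by rw [srwLaw_zero_apply, if_pos rfl]
  have hp1 : srwLaw d 1 (0 : Fin d → ℤ) = 0 := by simpa using srwLaw_odd_zero (d := d) 0
  have hp3 : srwLaw d 3 (0 : Fin d → ℤ) = 0 := by simpa using srwLaw_odd_zero (d := d) 1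
  have hp5 : srwLaw d 5 (0 : Fin d → ℤ) = 0 := by simpa using srwLaw_odd_zero (d := d) 2
  have hp7 : srwLaw d 7 (0 : Fin d → ℤ) = 0 := by simpa using srwLaw_odd_zero (d := d) 3
  have hp9 : srwLaw d 9 (0 : Fin d → ℤ) = 0 := by simpa using srwLaw_odd_zero (d := d) 4
  have hp11 : srwLaw d 11 (0 : Fin d → ℤ) = 0 := by simpa using srwLaw_odd_zero (d := d) 5
  have hp2 : srwLaw d 2 (0 : Fin d → ℤ) = 1 / (2 * (d : ℝ)) := srwLaw_two_zero hd1
  have hp4 : srwLaw d 4 (0 : Fin d → ℤ) = 3 / (4 * (d : ℝ) ^ 2) - 3 / (8 * (d : ℝ) ^ 3) := srwLaw_four_zero hd1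
  have hp6 : srwLaw d 6 (0 : Fin d → ℤ) = 15 / (8 * (d : ℝ) ^ 3) - 45 / (16 * (d : ℝ) ^ 4) + 5 / (4 * (d : ℝ) ^ 5) :=
    srwLaw_six_zero hd1
  have hp8 : srwLaw d 8 (0 : Fin d → ℤ) ≤ 105 / (16 * (d : ℝ) ^ 4) := by
    have := srwLaw_two_mul_zero_le hd1 4
    norm_num [Nat.doubleFactorial] at this
    have e : (2 * (d : ℝ)) ^ 4 = 16 * (d : ℝ) ^ 4 := by ring
    rw [e] at this
    exact this
  have hp10 : srwLaw d 10 (0 : Fin d → ℤ) ≤ 945 / (32 * (d : ℝ) ^ 5) := by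
    have := srwLaw_two_mul_zero_le hd1 5
    norm_num [Nat.doubleFactorial] at this
    have e : (2 * (d : ℝ)) ^ 5 = 32 * (d : ℝ) ^ 5 := by ring
    rw [e] at this
    exact this
  have hsum : ∑ i ∈ range (11 + 1), (((i + 0).choose 0 : ℕ) : ℝ) * srwLaw d (0 + i) 0 =
      1 + srwLaw d 2 0 + srwLaw d 4 0 + srwLaw d 6 0 + srwLaw d 8 0 + srwLaw d 10 0 := by
    simp only [Finset.sum_range_succ, Finset.sum_range_zero, Nat.add_zero, Nat.choose_zero_right, Nat.cast_one,
      one_mul, Nat.zero_add, hp0, hp1, hp3, hp5, hp7, hp9, hp11]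
    ring
  have hrem : ∑ t ∈ range (0 + 1), (((11 + t).choose t : ℕ) : ℝ) *
      (Real.sqrt ((((2 * (0 + 11 + 1) - 1)‼ : ℕ) : ℝ) / (2 * (d : ℝ)) ^ (0 + 11 + 1)) *
        (2 : ℝ) ^ (6 * (0 + 1 - t) + 1)) ≤ 1124696 / (d : ℝ) ^ 6 := by
    have h23 : (((2 * (0 + 11 + 1) - 1)‼ : ℕ) : ℝ) = 316234143225 := by norm_num [Nat.doubleFactorial]
    simp only [Finset.sum_range_succ, Finset.sum_range_zero, zero_add, Nat.add_zero, Nat.choose_zero_right,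
      Nat.cast_one, one_mul, h23]
    norm_num
    have hs12 : Real.sqrt ((2 * (d : ℝ)) ^ 12) = (2 * (d : ℝ)) ^ 6 := by
      rw [show (2 * (d : ℝ)) ^ 12 = ((2 * (d : ℝ)) ^ 6) ^ 2 by ring, Real.sqrt_sq (by positivity)]
    have hs1 : Real.sqrt 316234143225 ≤ 562348 := by
      rw [show (562348 : ℝ) = Real.sqrt (562348 ^ 2) by rw [Real.sqrt_sq (by norm_num)]]
      exact Real.sqrt_le_sqrt (by norm_num)
    have hs0 : 0 ≤ Real.sqrt 316234143225 := Real.sqrt_nonneg _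
    rw [hs12, div_mul_eq_mul_div, div_le_div_iff₀ (by positivity) (by positivity)]
    have hd6 : (0 : ℝ) < (d : ℝ) ^ 6 := by positivity
    nlinarith [mul_le_mul_of_nonneg_right hs1 hd6.le]
  have hmain := (abs_sub_le_iff.1 h).1
  rw [hsum] at hmain
  have e1 : (15 : ℝ) / (8 * (d : ℝ) ^ 3) - 3 / (8 * (d : ℝ) ^ 3) = 3 / (2 * (d : ℝ) ^ 3) := by
    field_simp
    ring
  have e2 : (105 : ℝ) / (16 * (d : ℝ) ^ 4) - 45 / (16 * (d : ℝ) ^ 4) = 15 / (4 * (d : ℝ) ^ 4) := by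
    field_simp
    ring
  have e3 : (5 : ℝ) / (4 * (d : ℝ) ^ 5) + 945 / (32 * (d : ℝ) ^ 5) = 985 / (32 * (d : ℝ) ^ 5) := by
    field_simp
    ring
  linarith

/-! ### The renewal floor to third order: HSS93 (6.20) `s⁻¹ − 1 − s − 4s² − 22s³ − …` -/

/-- The renewal bound with the `R = 11` enclosure:
`2d / (2 − 1/(1 + 1/(2d) + 3/(4d²) + 3/(2d³) + 15/(4d⁴) + 985/(32d⁵) + 1124696/d⁶)) ≤ μ(ℤ^d)` (`d ≥ 5`).
[cite: HaraSladeSokal1993, Section 2.3, eq. (2.32)-(2.33); Section 6.3, eq. (6.20)] -/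
theorem two_mul_div_renewal_sharp₁₁_le_connectiveConstant (hd : 5 ≤ d) :
    2 * (d : ℝ) / (2 - 1 / (1 + 1 / (2 * (d : ℝ)) + 3 / (4 * (d : ℝ) ^ 2) + 3 / (2 * (d : ℝ) ^ 3) +
      15 / (4 * (d : ℝ) ^ 4) + 985 / (32 * (d : ℝ) ^ 5) + 1124696 / (d : ℝ) ^ 6)) ≤ connectiveConstant d :=
  two_mul_div_renewal_le_connectiveConstant_of_le (by omega) (srwI_one_zero_zero_le_sharp₁₁ hd)

/-- **Third-order Kesten floor with the printed `s³` coefficient of HSS93 (6.20):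
`2d − 1 − 1/(2d) − 1/d² − 11/(4d³) − 49/d⁴ − 2249392/d⁵ ≤ μ(ℤ^d)` for every `d ≥ 5`.** In `s = 1/(2d)`:
`s⁻¹ − 1 − s − 4s² − 22s³ − O(s⁴) ≤ μ`, the expansion (6.20) of the `(0,1)` bound through order `s³` as a rigorous
all-`d` inequality (the series of the `R = 11` floor is `… − 22s³ − 773s⁴ − …`; `49·16 = 784 ≥ 773` and
`2249392 = 2·1124696` absorb the rest). It exceeds the `R = 9` closed form `kesten_second_order_renewal_sharp₉`
from `d = 11` on (`d = 12`: 13.908 vs 13.074; `d = 20`: 38.269 vs 37.692; `d = 100`: 198.994672 vs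
198.992844, against `μ(ℤ¹⁰⁰) = 198.99492…` from (6.18)); it is negative for `d ≤ 10`.
[cite: HaraSladeSokal1993, Section 6.3, eq. (6.20) (mu^(0,1) = s^-1 - 1 - s - 4s^2 - 22s^3 - 143s^4 + O(s^5))] -/
theorem kesten_third_order_renewal_sharp₁₁ (hd : 5 ≤ d) :
    2 * (d : ℝ) - 1 - 1 / (2 * (d : ℝ)) - 1 / (d : ℝ) ^ 2 - 11 / (4 * (d : ℝ) ^ 3) - 49 / (d : ℝ) ^ 4 -
        2249392 / (d : ℝ) ^ 5 ≤ connectiveConstant d := by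
  have hd5 : (5 : ℝ) ≤ d := by exact_mod_cast hd
  have hd0 : (0 : ℝ) < d := by linarith
  refine le_trans ?_ (two_mul_div_renewal_sharp₁₁_le_connectiveConstant hd)
  set B : ℝ := 1 + 1 / (2 * (d : ℝ)) + 3 / (4 * (d : ℝ) ^ 2) + 3 / (2 * (d : ℝ) ^ 3) + 15 / (4 * (d : ℝ) ^ 4) +
    985 / (32 * (d : ℝ) ^ 5) + 1124696 / (d : ℝ) ^ 6 with hB
  have hB1 : 1 ≤ B := by
    rw [hB]
    have : (0 : ℝ) ≤ 1 / (2 * (d : ℝ)) + 3 / (4 * (d : ℝ) ^ 2) + 3 / (2 * (d : ℝ) ^ 3) + 15 / (4 * (d : ℝ) ^ 4) +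
        985 / (32 * (d : ℝ) ^ 5) + 1124696 / (d : ℝ) ^ 6 := by
      positivity
    linarith
  have hB0 : 0 < B := by linarith
  have hW : (0 : ℝ) < 2 - 1 / B := by
    have : 1 / B ≤ 1 := by rw [div_le_one hB0]; exact hB1
    linarith
  rw [le_div_iff₀ hW, hB]
  have key : (2 * (d : ℝ) - 1 - 1 / (2 * (d : ℝ)) - 1 / (d : ℝ) ^ 2 - 11 / (4 * (d : ℝ) ^ 3) - 49 / (d : ℝ) ^ 4 -
        2249392 / (d : ℝ) ^ 5) *
      (2 - 1 / (1 + 1 / (2 * (d : ℝ)) + 3 / (4 * (d : ℝ) ^ 2) + 3 / (2 * (d : ℝ) ^ 3) + 15 / (4 * (d : ℝ) ^ 4) +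
        985 / (32 * (d : ℝ) ^ 5) + 1124696 / (d : ℝ) ^ 6)) =
      2 * d - (44 * (d : ℝ) ^ 7 + 7772 * (d : ℝ) ^ 6 + 287929858 * (d : ℝ) ^ 5 + 287936844 * (d : ℝ) ^ 4 +
          575878707 * (d : ℝ) ^ 3 + 1475794212 * (d : ℝ) ^ 2 + 15916697792 * d + 323824919658496) /
        (2 * (d : ℝ) ^ 5 * (32 * (d : ℝ) ^ 6 + 16 * (d : ℝ) ^ 5 + 24 * (d : ℝ) ^ 4 + 48 * (d : ℝ) ^ 3 +
          120 * (d : ℝ) ^ 2 + 985 * d + 35990272)) := by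
    field_simp
    ring
  rw [key]
  have : (0 : ℝ) ≤ (44 * (d : ℝ) ^ 7 + 7772 * (d : ℝ) ^ 6 + 287929858 * (d : ℝ) ^ 5 + 287936844 * (d : ℝ) ^ 4 +
          575878707 * (d : ℝ) ^ 3 + 1475794212 * (d : ℝ) ^ 2 + 15916697792 * d + 323824919658496) /
        (2 * (d : ℝ) ^ 5 * (32 * (d : ℝ) ^ 6 + 16 * (d : ℝ) ^ 5 + 24 * (d : ℝ) ^ 4 + 48 * (d : ℝ) ^ 3 +
          120 * (d : ℝ) ^ 2 + 985 * d + 35990272)) := by positivity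
  linarith

end Literature.Probability.RandomPlanarGeometry.SAW.Zd.LoopErasure

end
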